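import Mathlib
import Summits.NavierStokesRegularity.NavierStokesRegularity.Theorems.TaoLadderRungTwoBreakOneShiftWindowResidualSlope
import HarnessLib

/-!
# The one-shift window system, XIII: the RUN SLOPE (hypothesis `hV` of part XI) from a FLOW SLOPE at the flight
# time and the TIME SLOPE of the run, and the composition of per-step pair slopes along a step chain
# (cell harvest/h2-tao-ladder, seat p2; rung1/KERNEL-CHEAP-REPLAY-SPEC.md §2 (g)/(h) and §3 S2–S3,
# rung1/RUNG1-P2G12-REPORT.md §54; support for K1(1) = `NoSurvivingDSSOne`, stmt-NavierStokesRegularity-20205)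

MODEL lattice ODEs only (Tao 2016 §4 normal form on Tao's shift set `S`); nothing here is a statement about
the Navier–Stokes equations; no item is closed; nothing numerical is proved.

Part XI (`exists_residualSlope`) consumes ONE analytic input about a pair `u, v` of `AdmLip` points with the same
tails: a slope representation of the difference of their window runs at their own flight times,
`runAt u − runAt v = V · Δ` on the window (`Δ` = scaled difference of the window parts). This file splits it
into the two things a validated integration produces and composes the first along the step chain:

* `exists_slope_of_hasDerivWithinAt_Icc` — 1-D mean-value slope for a function differentiable within an interval;
* `runSlopeOf U φ` — the run-slope matrix with window columns `U i k c · a_c` (flow slope × box radius) and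
  flight-time column `φ i k · r_τ` (field value × flight-time radius);
* `exists_runSlope` — **flow slope at the common time `τ_u`** (`S_u(τ_u) − S_v(τ_u) = U · (y_u − y_v)` on the
  window, `U` a real matrix depending on the pair — what a slope/C¹ enclosure of the window flow delivers) **+ the
  window equations for the run of `v`** (`HasDerivWithinAt` with field values `fv`) ⇒ `hV` of part XI with
  `V = runSlopeOf U (fv ∘ θ)` for intermediate times `θ_{i,k}` between the two flight times (so the flight-time
  column lies in `r_τ ·` the field hull over the flight-time box);
* `exists_chainSlope` — per-step pair slopes compose: if at every step the difference of two solutions is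
  transported by SOME real matrix inside the step's interval matrix, then over the chain it is transported by the
  ordered product of such matrices (the replay encloses that product by interval matrix products, part IX for the
  banded bookkeeping). Generic in the index type.
-/

noncomputable section

-- the sub-problem namespace repeats the summit name by design (D-0017)
set_option linter.dupNamespace false

namespace Summit.NavierStokesRegularity.NavierStokesRegularity.Theorems

namespace DSSOneShift

open Set Metric Literature.Analysis.FluidPDE Literature.Analysis.FluidPDE.TaoCascade CertificateGlueOn

variable {m : ℕ}

/-! ### A mean-value slope within an interval -/

/-- **Mean-value slope within an interval**: if `f` has derivative `f' x` within `[a, b]` at every `x ∈ [a, b]`,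
then for `τ, τ' ∈ [a, b]` there is `θ` between them with `f τ − f τ' = f' θ · (τ − τ')`. [folklore] -/
theorem exists_slope_of_hasDerivWithinAt_Icc {f f' : ℝ → ℝ} {a b : ℝ}
    (hf : ∀ x ∈ Icc a b, HasDerivWithinAt f (f' x) (Icc a b) x) {τ τ' : ℝ} (hτ : τ ∈ Icc a b)
    (hτ' : τ' ∈ Icc a b) : ∃ θ ∈ uIcc τ' τ, f τ - f τ' = f' θ * (τ - τ') := by
  -- the ordered case
  have key : ∀ p q : ℝ, p ∈ Icc a b → q ∈ Icc a b → p < q →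
      ∃ θ ∈ Ioo p q, f q - f p = f' θ * (q - p) := by
    intro p q hp hq hpq
    have hsub : Icc p q ⊆ Icc a b := Icc_subset_Icc hp.1 hq.2
    have hcont : ContinuousOn f (Icc p q) := fun x hx =>
      ((hf x (hsub hx)).continuousWithinAt).mono hsub
    have hder : ∀ x ∈ Ioo p q, HasDerivAt f (f' x) x := fun x hx =>
      (hf x (hsub (Ioo_subset_Icc_self hx))).hasDerivAt
        (Icc_mem_nhds (hp.1.trans_lt hx.1) (hx.2.trans_le hq.2))
    obtain ⟨θ, hθ, h⟩ := exists_hasDerivAt_eq_slope f f' hpq hcont hder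
    exact ⟨θ, hθ, by rw [h, div_mul_cancel₀ _ (sub_ne_zero.2 hpq.ne')]⟩
  rcases lt_trichotomy τ' τ with hlt | heq | hgt
  · obtain ⟨θ, hθ, h⟩ := key τ' τ hτ' hτ hlt
    exact ⟨θ, by rw [uIcc_of_le hlt.le]; exact Ioo_subset_Icc_self hθ, h⟩
  · subst heq; exact ⟨τ', by simp, by simp⟩
  · obtain ⟨θ, hθ, h⟩ := key τ τ' hτ hτ' hgt
    refine ⟨θ, by rw [uIcc_comm, uIcc_of_le hgt.le]; exact Ioo_subset_Icc_self hθ, ?_⟩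
    have e : f τ - f τ' = -(f τ' - f τ) := by ring
    rw [e, h]; ring

/-! ### Composition of per-step pair slopes along a chain -/

/-- **Per-step pair slopes compose along a chain.** If the differences `d s` of two solutions at the step times
satisfy, at every step `s < S`, `d (s+1) = U_s · d s` for SOME real matrix `U_s` inside the step's interval matrix
`[lo s, hi s]`, then `d S = (U_{S-1} ⋯ U_0) · d 0` for such a family — the real-number side of the replay's
`V_{s+1} ⊇ A_s · V_s`. [cite: Tao2016AveragedNS, §5.3; cell vocabulary, harvest/h2-tao-ladder rung1/KERNEL-CHEAP-REPLAY-SPEC.md §2 (g)] -/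
theorem exists_chainSlope {ι : Type*} [Fintype ι] [DecidableEq ι] (d : ℕ → ι → ℝ)
    (lo hi : ℕ → Matrix ι ι ℝ)
    (hstep : ∀ s, ∃ U : Matrix ι ι ℝ, (∀ i j, lo s i j ≤ U i j ∧ U i j ≤ hi s i j) ∧
      d (s + 1) = U.mulVec (d s)) (S : ℕ) :
    ∃ U : ℕ → Matrix ι ι ℝ, (∀ s, ∀ i j, lo s i j ≤ U s i j ∧ U s i j ≤ hi s i j) ∧
      d S = ((List.range S).map U).reverse.prod.mulVec (d 0) := by
  choose U hU hd using hstep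
  refine ⟨U, hU, ?_⟩
  induction S with
  | zero => simp
  | succ S ih =>
    rw [hd S, ih, Matrix.mulVec_mulVec, List.range_succ, List.map_append, List.reverse_append,
      List.prod_append]
    simp

namespace OneShiftFrame

variable (F : OneShiftFrame m)

/-! ### The run slope from a flow slope and a time slope -/

/-- **The run-slope matrix** from a flow slope `U` (unscaled window-start columns) and field values `φ`: window
columns `U i k c · a_c`, flight-time column `φ i k · r_τ`. [cite: Tao2016AveragedNS, §5.3; cell vocabulary, harvest/h2-tao-ladder rung1/KERNEL-CHEAP-REPLAY-SPEC.md §2 ([DG] from (z-hull, V_B, f-hull))] -/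
def runSlopeOf (U : Fin m → ℤ → Fin m × Fin F.W → ℝ) (φ : Fin m → ℤ → ℝ) : Fin m → ℤ → F.WIdx → ℝ :=
  fun i k c => c.elim (φ i k * F.rτ) fun p => U i k p * F.a p.1 ((p.2 : ℕ) : ℤ)

/-- **THE RUN SLOPE (`hV` of part XI) from a flow slope at the flight time of `u` and the window equations of the
run of `v`.** Let `S_u`, `S_v` be the window runs (`windowRunMap`) of two `AdmLip` points with the same tails from
their pre-clamped data (same tails in the application), `τ_u`, `τ_v` their flight times. If on the window
`S_u(τ_u) − S_v(τ_u) = U · (y_u − y_v)`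
for a real matrix `U` (flow slope), and the run of `v` satisfies the window equations with field values `fv` on the
flight (`HasDerivWithinAt`), then there are intermediate times `θ_{i,k}` between `τ_v` and `τ_u` with
`runAt u − runAt v = runSlopeOf U (fv ∘ θ) · Δ` on the window.
[cite: Tao2016AveragedNS, §5.3; cell vocabulary, harvest/h2-tao-ladder rung1/KERNEL-CHEAP-REPLAY-SPEC.md §2/§3 (S2, S4)] -/
theorem exists_runSlope {ε₀ : ℝ} {α : Fin m → Fin m → Fin m → ℤ × ℤ × ℤ → ℝ} {R : ℤ → ℝ} {u v : F.Space}
    (hu : F.AdmLip R u) (hv : F.AdmLip R v) {U : Fin m → ℤ → Fin m × Fin F.W → ℝ}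
    (hU : ∀ i k, F.InWindow k →
      F.windowRunMap ε₀ α (F.preclampY u) (F.preclampTail u) i k (F.preclampTau u) -
        F.windowRunMap ε₀ α (F.preclampY v) (F.preclampTail v) i k (F.preclampTau u) =
      ∑ c : Fin m × Fin F.W, U i k c *
        (F.preclampY u c.1 ((c.2 : ℕ) : ℤ) - F.preclampY v c.1 ((c.2 : ℕ) : ℤ)))
    {fv : Fin m → ℤ → ℝ → ℝ}
    (hderiv : ∀ i k, F.InWindow k → ∀ t ∈ Icc 0 F.τhi,
      HasDerivWithinAt (fun s => F.windowRunMap ε₀ α (F.preclampY v) (F.preclampTail v) i k s) (fv i k t)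
        (Icc 0 F.τhi) t) :
    ∃ θ : Fin m → ℤ → ℝ, (∀ i k, F.InWindow k → θ i k ∈ uIcc (F.preclampTau v) (F.preclampTau u)) ∧
      ∀ i k, F.InWindow k → F.runAt ε₀ α u i k - F.runAt ε₀ α v i k =
        ∑ c, F.runSlopeOf U (fun i k => fv i k (θ i k)) i k c * (F.coord (F.winPart u) c - F.coord (F.winPart v) c) := by
  classical
  -- time slopes of the run of `v` between the two flight times, component by component
  have hτu := F.preclampTau_mem u
  have hτv := F.preclampTau_mem v
  have hslope : ∀ i k, F.InWindow k → ∃ θ ∈ uIcc (F.preclampTau v) (F.preclampTau u),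
      F.windowRunMap ε₀ α (F.preclampY v) (F.preclampTail v) i k (F.preclampTau u) -
        F.windowRunMap ε₀ α (F.preclampY v) (F.preclampTail v) i k (F.preclampTau v) =
      fv i k θ * (F.preclampTau u - F.preclampTau v) := fun i k hk =>
    exists_slope_of_hasDerivWithinAt_Icc (hderiv i k hk) hτu hτv
  -- choose the intermediate times (junk off the window)
  have hchoice : ∀ i k, ∃ θ : ℝ, F.InWindow k → θ ∈ uIcc (F.preclampTau v) (F.preclampTau u) ∧
      F.windowRunMap ε₀ α (F.preclampY v) (F.preclampTail v) i k (F.preclampTau u) -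
        F.windowRunMap ε₀ α (F.preclampY v) (F.preclampTail v) i k (F.preclampTau v) =
      fv i k θ * (F.preclampTau u - F.preclampTau v) := by
    intro i k
    by_cases hk : F.InWindow k
    · obtain ⟨θ, hθ, h⟩ := hslope i k hk
      exact ⟨θ, fun _ => ⟨hθ, h⟩⟩
    · exact ⟨0, fun h => absurd h hk⟩
  choose θ hθ using hchoice
  refine ⟨θ, fun i k hk => (hθ i k hk).1, fun i k hk => ?_⟩
  have htime := (hθ i k hk).2
  -- split through the run of `v` at the flight time of `u`
  have esplit : F.runAt ε₀ α u i k - F.runAt ε₀ α v i k =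
      (F.windowRunMap ε₀ α (F.preclampY u) (F.preclampTail u) i k (F.preclampTau u) -
        F.windowRunMap ε₀ α (F.preclampY v) (F.preclampTail v) i k (F.preclampTau u)) +
      (F.windowRunMap ε₀ α (F.preclampY v) (F.preclampTail v) i k (F.preclampTau u) -
        F.windowRunMap ε₀ α (F.preclampY v) (F.preclampTail v) i k (F.preclampTau v)) := by
    simp only [runAt, slice]; ring
  rw [esplit, hU i k hk, htime, F.preclampTau_sub hu hv, Fintype.sum_option]
  simp only [runSlopeOf, Option.elim, coord_none, coord_some', winPart]
  rw [add_comm]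
  congr 1
  · ring
  · refine Finset.sum_congr rfl fun c _ => ?_
    have h := F.preclampY_sub hu hv c.1 c.2
    linear_combination (U i k c) * h

end OneShiftFrame

end DSSOneShift

end Summit.NavierStokesRegularity.NavierStokesRegularity.Theorems
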